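import Literature.AlgebraicGeometry.Resolution.ExceptionalDivisorProjectiveBundle
import Literature.AlgebraicGeometry.Resolution.BlowupStalkCharts
import Literature.AlgebraicGeometry.Resolution.AffineBlowupIntegral
import Literature.AlgebraicGeometry.Resolution.RegularQuotientIdeal
import Literature.AlgebraicGeometry.Motives.ProjBaseChangeAny
import HarnessLib

/-!
# The fibre of a blowing up over a point `y` of the centre with `J_y = 𝔪_y` (regular) is irreducible

Topic: `Literature/AlgebraicGeometry/Resolution`. For a blowing up `π : X' → X` (`IsBlowup π J`) and a point `y`
with regular local ring `𝒪_{X,y}` of dimension `≥ 1` at which the blown-up ideal has stalk `J_y = 𝔪_y` (e.g. the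
blowing up of a closed point, or of a regular centre at its generic point), the fibre `π⁻¹(y)` is an irreducible
subset of `X'` — it is the image of `ℙ^{m−1}_{κ(y)}`: base change to `Spec 𝒪_{X,y}` (blowing ups commute with the
flat `Spec 𝒪_{X,y} → X`, `IsBlowup.pullback_snd_of_flat`; uniqueness `IsBlowup.unique`) identifies
`X' ×_X Spec 𝒪_{X,y}` with `Proj 𝒪_{X,y}[𝔪 t]` (`affineBlowup`), whose fibre over the closed point is
`ℙ^{m−1}_{κ(y)}` (`isPullback_exceptional_projectiveSpace`, Hartshorne II 8.24 (b) in chart form; base change of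
projective space `isPullback_projMap'`), irreducible (`Proj.irreducibleSpace`). [folklore]

## Sources
* R. Hartshorne, *Algebraic Geometry* (1977), II Thm. 8.24 (b). [Hartshorne1977]
* The Stacks Project, Tags 0804, 0805, 01J7. [StacksProject]
-/

noncomputable section

open CategoryTheory CategoryTheory.Limits AlgebraicGeometry TopologicalSpace IsLocalRing HomogeneousLocalization
open Literature.AlgebraicGeometry.Motives Literature.AlgebraicGeometry.Motives.ProjBaseChangeRing

namespace Literature.AlgebraicGeometry.Resolution

universe u

open Scheme.IdealSheafData

/-- **Irreducibility of the exceptional fibre of the affine model**: for a quasi-regular sequence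
`c = (c₀, …, c_r)` in a ring `R` generating a MAXIMAL ideal, the fibre of `Bl_{(c)}(Spec R) → Spec R` over the
point `(c)` is irreducible (it is `ℙʳ_{R/(c)}`). [cite: Hartshorne1977, II Thm. 8.24 (b)] -/
theorem affineBlowup.isIrreducible_preimage_of_isQuasiRegular {R : Type u} [CommRing R] {r : ℕ}
    (c : Fin (r + 1) → R) (hc : IsQuasiRegular c) (hmax : (Ideal.span (Set.range c)).IsMaximal) :
    IsIrreducible ((affineBlowup.π (Ideal.span (Set.range c))) ⁻¹'
      {(⟨Ideal.span (Set.range c), hmax.isPrime⟩ : PrimeSpectrum R)}) := by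
  classical
  letI : Field (R ⧸ Ideal.span (Set.range c)) := Ideal.Quotient.field _
  -- the standard grading of `(R/𝔪)[T₀, …, T_r]` (Mathlib keeps it a `def`; used as a local instance inside this proof only)
  letI : GradedRing (MvPolynomial.homogeneousSubmodule (Fin (r + 1)) (R ⧸ Ideal.span (Set.range c))) :=
    MvPolynomial.gradedAlgebra
  -- the closed immersion `j : Spec (R/𝔪) → Spec R` with kernel the ideal sheaf of `𝔪`
  haveI : IsClosedImmersion (Spec.map (CommRingCat.ofHom (Ideal.Quotient.mk (Ideal.span (Set.range c))))) :=
    IsClosedImmersion.spec_of_surjective _ Ideal.Quotient.mk_surjective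
  have hjker : (Spec.map (CommRingCat.ofHom (Ideal.Quotient.mk (Ideal.span (Set.range c))))).ker =
      affineBlowup.idealSheaf (Ideal.span (Set.range c)) := by
    rw [ker_specMap_eq_idealSheaf, Ideal.mk_ker]
  -- the exceptional fibre `E = Bl ×_{Spec R} Spec (R/𝔪)` is `ℙʳ_{R/𝔪}`
  have h1 := isPullback_exceptional_projectiveSpace c _ hjker hc
  have h2 := isPullback_projMap' R (R ⧸ Ideal.span (Set.range c)) (n := r)
  rw [Ideal.Quotient.algebraMap_eq] at h2
  let e := h1.isoIsPullback _ _ h2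
  -- `ℙʳ` over a field is irreducible, hence so is `E` and its image in `Bl`
  haveI : IrreducibleSpace
      ↑(Proj (MvPolynomial.homogeneousSubmodule (Fin (r + 1)) (R ⧸ Ideal.span (Set.range c)))) :=
    Proj.irreducibleSpace _ (by
      -- the irrelevant ideal contains `T₀ ≠ 0`
      intro h
      have hx : (MvPolynomial.X 0 : MvPolynomial (Fin (r + 1)) (R ⧸ Ideal.span (Set.range c))) ∈
          (HomogeneousIdeal.irrelevant
            (MvPolynomial.homogeneousSubmodule (Fin (r + 1)) (R ⧸ Ideal.span (Set.range c)))).toIdeal :=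
        HomogeneousIdeal.mem_irrelevant_of_mem _ zero_lt_one (MvPolynomial.isHomogeneous_X _ 0)
      rw [h] at hx
      exact MvPolynomial.X_ne_zero 0 ((Submodule.mem_bot _).1 hx))
  have hrange : Set.range (Spec.map (CommRingCat.ofHom (Ideal.Quotient.mk (Ideal.span (Set.range c))))) =
      {(⟨Ideal.span (Set.range c), hmax.isPrime⟩ : PrimeSpectrum R)} := by
    refine Set.eq_singleton_iff_unique_mem.mpr ⟨⟨⟨⊥, Ideal.isPrime_bot⟩, ?_⟩, ?_⟩
    · apply PrimeSpectrum.ext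
      rw [Spec.map_apply, CommRingCat.hom_ofHom, PrimeSpectrum.comap_asIdeal, ← RingHom.ker_eq_comap_bot,
        Ideal.mk_ker]
    · rintro _ ⟨q, rfl⟩
      apply PrimeSpectrum.ext
      have hle : Ideal.span (Set.range c) ≤
          (Spec.map (CommRingCat.ofHom (Ideal.Quotient.mk (Ideal.span (Set.range c)))) q).asIdeal := by
        intro a ha
        rw [Spec.map_apply, CommRingCat.hom_ofHom, PrimeSpectrum.comap_asIdeal, Ideal.mem_comap,
          Ideal.Quotient.eq_zero_iff_mem.mpr ha]
        exact zero_mem _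
      exact (hmax.eq_of_le (PrimeSpectrum.isPrime _).ne_top hle).symm
  rw [← hrange, ← Scheme.Pullback.range_fst]
  -- `range fst = fst '' (e.inv '' univ)`
  have hsurj : Function.Surjective e.inv := (Scheme.homeoOfIso e.symm).surjective
  have : Set.range (pullback.fst (affineBlowup.π (Ideal.span (Set.range c)))
      (Spec.map (CommRingCat.ofHom (Ideal.Quotient.mk (Ideal.span (Set.range c)))))) =
      (fun z => pullback.fst (affineBlowup.π (Ideal.span (Set.range c)))
        (Spec.map (CommRingCat.ofHom (Ideal.Quotient.mk (Ideal.span (Set.range c))))) (e.inv z)) ''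
        Set.univ := by
    rw [Set.image_univ]
    ext w
    constructor
    · rintro ⟨z, rfl⟩
      obtain ⟨z', rfl⟩ := hsurj z
      exact ⟨z', rfl⟩
    · rintro ⟨z', rfl⟩
      exact ⟨_, rfl⟩
  rw [this]
  exact (IrreducibleSpace.isIrreducible_univ _).image _
    ((Scheme.Hom.continuous _).comp (Scheme.Hom.continuous _)).continuousOn

/-- **The fibre of a blowing up over a point `y` with `𝒪_{X,y}` regular of positive dimension and `J_y = 𝔪_y` is
irreducible** (it is a `ℙ^{m−1}` over `κ(y)`). [cite: Hartshorne1977, II Thm. 8.24 (b)] -/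
theorem IsBlowup.isIrreducible_preimage_singleton {X X' : Scheme.{u}} {π : X' ⟶ X} {J : X.IdealSheafData}
    (hπ : IsBlowup π J) (y : X) [IsRegularLocalRing (X.presheaf.stalk y)]
    (hy : stalkIdeal J y = maximalIdeal (X.presheaf.stalk y))
    (hne : maximalIdeal (X.presheaf.stalk y) ≠ ⊥) :
    IsIrreducible (π ⁻¹' {y}) := by
  classical
  -- quasi-regular generators `c` of `𝔪_y`, `c : Fin (r+1) → 𝒪_{X,y}`
  letI : Field (X.presheaf.stalk y ⧸ maximalIdeal (X.presheaf.stalk y)) := Ideal.Quotient.field _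
  obtain ⟨k, c, -, hcspan, hcq, -⟩ :=
    exists_isQuasiRegular_span_eq_of_isRegularLocalRing_quotient (le_refl (maximalIdeal (X.presheaf.stalk y)))
      (maximalIdeal (X.presheaf.stalk y) : Set (X.presheaf.stalk y)) (Ideal.span_eq _)
  obtain ⟨r, rfl⟩ : ∃ r, k = r + 1 := by
    refine Nat.exists_eq_add_one_of_ne_zero fun hk => hne ?_
    subst hk
    rw [← hcspan, Set.range_eq_empty, Ideal.span_empty]
  have hmax : (Ideal.span (Set.range c)).IsMaximal := hcspan ▸ inferInstance
  -- base change to `Spec 𝒪_{X,y}`: a blowing up along `(𝔪_y)~`, hence `≅ Proj 𝒪_{X,y}[𝔪 t]`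
  haveI : Flat (X.fromSpecStalk y) := flat_fromSpecStalk X y
  have hP : IsBlowup (pullback.snd π (X.fromSpecStalk y)) (affineBlowup.idealSheaf (Ideal.span (Set.range c))) := by
    have h := hπ.pullback_snd_of_flat (X.fromSpecStalk y)
    rwa [comap_fromSpecStalk_eq_affineBlowupIdealSheaf, hy, ← hcspan] at h
  obtain ⟨e, he, -⟩ := (affineBlowup.isBlowup (Ideal.span (Set.range c))).unique hP
  -- the fibre over `y` is the image of the fibre of the affine model over the closed point
  have hclosed : (⟨Ideal.span (Set.range c), hmax.isPrime⟩ : PrimeSpectrum (X.presheaf.stalk y)) =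
      closedPoint (X.presheaf.stalk y) := by
    apply PrimeSpectrum.ext
    exact hcspan
  have hfib := affineBlowup.isIrreducible_preimage_of_isQuasiRegular c hcq hmax
  rw [hclosed] at hfib
  have himage : π ⁻¹' {y} =
      (fun a => pullback.fst π (X.fromSpecStalk y) (e.hom a)) ''
        ((affineBlowup.π (Ideal.span (Set.range c))) ⁻¹' {closedPoint (X.presheaf.stalk y)}) := by
    ext x'
    constructor
    · intro hx'
      rw [Set.mem_preimage, Set.mem_singleton_iff] at hx'
      obtain ⟨z, hz⟩ := mem_range_pullback_fst_fromSpecStalk_of_eq π y (x' := x') hx'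
      obtain ⟨a, rfl⟩ := (Scheme.homeoOfIso e).surjective z
      refine ⟨a, ?_, hz⟩
      change affineBlowup.π (Ideal.span (Set.range c)) a = closedPoint (X.presheaf.stalk y)
      apply (X.fromSpecStalk y).isEmbedding.injective
      rw [Scheme.fromSpecStalk_closedPoint, ← he, Scheme.Hom.comp_apply, ← Scheme.Hom.comp_apply,
        ← pullback.condition, Scheme.Hom.comp_apply]
      rw [← Scheme.homeoOfIso_apply, hz, hx']
    · rintro ⟨a, ha, rfl⟩
      have ha' : affineBlowup.π (Ideal.span (Set.range c)) a = closedPoint (X.presheaf.stalk y) := ha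
      change (e.hom ≫ pullback.fst π (X.fromSpecStalk y) ≫ π) a = y
      rw [pullback.condition, ← Category.assoc, he, Scheme.Hom.comp_apply, ha',
        Scheme.fromSpecStalk_closedPoint]
  rw [himage]
  exact hfib.image _ ((Scheme.Hom.continuous _).comp (Scheme.Hom.continuous _)).continuousOn

end Literature.AlgebraicGeometry.Resolution

end
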